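import Mathlib
import HarnessLib
import Summits.MatrixMultiplication.MatrixMultiplication.Theorems.OutsiderSandwichFaceLocalisation

/-!
# OutsiderSandwich — FACE LOCALISATION in a Strassen preorder, II: certificates, the MAX FORMULA on a
face, and subsidies (face versus top fibre)
(decomp-mm lens 4 «minimal counterexample / extremal reduction», gen 35, part 2/3: abstract theory)

Route `route-MatrixMultiplication-OutsiderSandwich`; cut of record UNCHANGED
(`closes (h₁ : LaserTangency) (h₂ : LaserMergeOptimal) (h₃ : SummitIffLaserTangency)`); theorem-only,
definition-free support for the residual `LaserMergeOptimal` (stmt-27897).  Continues part 1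
(`OutsiderSandwichFaceLocalisation`): `≼` a Strassen preorder on `S`, `X` its spectrum, `u ≼~ v` valid,
`Z(u,v) = {φ ∈ X : φ(u) = φ(v)}` its face.

§1 **Certificates** (`face_le_of_cert`, `exists_cert_of_faceLt`, `exists_pos_cert_of_faceLt`):
   `(p, q, n) ∈ ℕ³` is a CERTIFICATE for `x` on `Z(u,v)` when `q·x + n·u ≼~ p + n·v`; it bounds
   `q·φ(x) ≤ p` on the face, and every strict rational bound on the face comes from one.

§2 **THE MAX FORMULA ON A FACE** (`isGLB_faceMax`, `faceMax_eq_sInf`, `faceLe_nat_iff_certs`): for the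
   attained maximum `M = max_{Z(u,v)} φ(x)`,

     `M = inf { p/q : q ≥ 1, ∃ n, q·x + n·u ≼~ p + n·v }`

   — Strassen duality for the rank LOCALISED AT A FACE, with certificates inside the ORIGINAL
   asymptotic preorder (no extended preorder); and for `c ∈ ℕ`:
   `(∀ φ ∈ Z, φ(x) ≤ c) ⟺ ∀ p > c·q, ∃ n, q·x + n·u ≼~ p + n·v`.

§3 **Face versus top fibre: SUBSIDIES** (`asympLe_natMul_natCast_iff`, `face_meets_top_iff_noSubsidy`,
   `face_misses_top_iff_subsidy`): the face MEETS the top fibre `{φ(a) = R̃(a)}` of g34 iff bundling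
   with `u ≼~ v` never undercuts the global price of `a`:
     `(∃ φ ∈ Z(u,v), φ(a) = R̃(a)) ⟺ ∀ p q n, (q·a + n·u ≼~ p + n·v) → (q·a ≼~ p)`,
   and MISSES it iff some certificate has `p < q·R̃(a)` (a SUBSIDY).  Part 3 reads the route's residual
   `LaserMergeOptimal` as «laser bundling never subsidises matrix multiplication».

Nearest prior art: Alman–Li–Pratt 2026 (arXiv:2604.01386) §3 Prop. 3.3 with Wigderson–Zuiddam 2023
Thm. 3.26 (`min_X φ(a)` over a closed subset as a sup/inf over an extended preorder); delta as in part 1: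
one natural multiplier, original preorder, exposed face of one valid inequality.
References: [cite: Zuiddam2018, Thm. 2.12, Cor. 2.13, Thm. 2.15]; [cite: Strassen1988, Thm. 2.3–2.4,
Thm. 3.8]; Alman–Li–Pratt, arXiv:2604.01386 (2026) §3; [WigdersonZuiddam2023] §3.
-/

set_option linter.dupNamespace false

namespace Summit.MatrixMultiplication.MatrixMultiplication.Theorems.OutsiderSandwichFaceCertificates

open Literature.Computability.AlgebraicComplexity
open Summit.MatrixMultiplication.MatrixMultiplication.Theorems.OutsiderSandwichFaceLocalisation

universe u

variable {S : Type u} [CommSemiring S] {le : S → S → Prop}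

/-! ## §1–§2  Certificates and the max formula on a face -/

/-- **Soundness of a certificate**: `q·x + n·u ≼~ p + n·v` gives `q·φ(x) ≤ p` at every point of the
face `Z(u,v)`. [cite: Zuiddam2018, Thm. 2.12] -/
theorem face_le_of_cert (h : IsStrassenPreorder le) {u v x : S} {p q n : ℕ}
    (hc : AsympLe le ((q : S) * x + (n : S) * u) ((p : S) + (n : S) * v)) :
    ∀ φ, IsSpectralPoint le φ → φ u = φ v → (q : ℝ) * φ x ≤ p := by
  intro φ hφ hφf
  have hineq := (h.asympLe_iff_forall_spectralPoint.1 hc) φ hφ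
  simp only [hφ.map_add, hφ.map_mul, hφ.map_natCast, hφf] at hineq
  linarith

/-- **Completeness**: a STRICT rational bound `q·φ(x) < p` on the face yields a certificate with the
same ratio, `(k·q)·x + n·u + 1 ≼~ k·p + n·v`. [cite: Zuiddam2018, Thm. 2.12, Thm. 2.15] -/
theorem exists_cert_of_faceLt (h : IsStrassenPreorder le) {u v x : S}
    (hval : ∀ φ, IsSpectralPoint le φ → φ u ≤ φ v) {p q : ℕ}
    (H : ∀ φ, IsSpectralPoint le φ → φ u = φ v → (q : ℝ) * φ x < p) :
    ∃ k n : ℕ, AsympLe le (((k * q : ℕ) : S) * x + (n : S) * u + 1)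
      (((k * p : ℕ) : S) + (n : S) * v) := by
  obtain ⟨k, n, hle⟩ := asympLe_of_faceLt h hval (x := (q : S) * x) (y := (p : S))
    (fun φ hφ hφf => by rw [hφ.map_mul, hφ.map_natCast, hφ.map_natCast]; exact H φ hφ hφf)
  refine ⟨k, n, ?_⟩
  have e1 : ((k * q : ℕ) : S) * x = (k : S) * ((q : S) * x) := by push_cast; ring
  have e2 : ((k * p : ℕ) : S) = (k : S) * (p : S) := by push_cast; ring
  rw [e1, e2]
  exact hle

/-- **Completeness with a positive level**: on a NONEMPTY face a strict bound `q·φ(x) < p` yields a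
certificate `(k·q)·x + n·u ≼~ k·p + n·v` with `k ≥ 1` (ratio `p/q`).
[cite: Zuiddam2018, Thm. 2.12, Thm. 2.15] -/
theorem exists_pos_cert_of_faceLt (h : IsStrassenPreorder le) {u v x : S}
    (hval : ∀ φ, IsSpectralPoint le φ → φ u ≤ φ v) {p q : ℕ}
    (hne : ∃ φ : S → ℝ, IsSpectralPoint le φ ∧ φ u = φ v)
    (H : ∀ φ, IsSpectralPoint le φ → φ u = φ v → (q : ℝ) * φ x < p) :
    ∃ k n : ℕ, 0 < k ∧
      AsympLe le (((k * q : ℕ) : S) * x + (n : S) * u) (((k * p : ℕ) : S) + (n : S) * v) := by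
  obtain ⟨k, n, hle⟩ := exists_cert_of_faceLt h hval H
  have hsp := h.asympLe_iff_forall_spectralPoint.1 hle
  obtain ⟨φ₀, hφ₀, hφ₀f⟩ := hne
  have hk : 0 < k := by
    refine Nat.pos_of_ne_zero fun hk0 => ?_
    subst hk0
    have h0 := hsp φ₀ hφ₀
    simp only [zero_mul, Nat.cast_zero, hφ₀.map_add, hφ₀.map_mul, hφ₀.map_natCast,
      hφ₀.map_one, hφ₀f] at h0
    linarith
  refine ⟨k, n, hk, h.asympLe_of_forall_spectralPoint _ _ fun φ hφ => ?_⟩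
  have h1 := hsp φ hφ
  simp only [hφ.map_add, hφ.map_mul, hφ.map_natCast, hφ.map_one] at h1 ⊢
  linarith

/-- A trivial certificate: `(R(x), 1, 0)` — `1·x + 0·u ≼~ R(x) + 0·v`. [cite: Zuiddam2018, Thm. 2.12] -/
theorem cert_rankOf (h : IsStrassenPreorder le) (u v x : S) :
    AsympLe le (((1 : ℕ) : S) * x + ((0 : ℕ) : S) * u) (((rankOf le x : ℕ) : S) + ((0 : ℕ) : S) * v) := by
  refine h.asympLe_of_forall_spectralPoint _ _ fun φ hφ => ?_
  simp only [hφ.map_natCast, Nat.cast_one, Nat.cast_zero, one_mul, zero_mul, add_zero]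
  exact hφ.le_rankOf h x

/-- **THE MAX FORMULA ON A FACE (localised Strassen duality).**  If `φ₀` maximises `φ(x)` on the face
`Z(u,v)` of a valid `u ≼~ v`, then `φ₀(x)` is the greatest lower bound of the certificate ratios
`{p/q : q ≥ 1, ∃ n, q·x + n·u ≼~ p + n·v}`.
[cite: Zuiddam2018, Thm. 2.12, Cor. 2.13, Thm. 2.15; Strassen1988, Thm. 3.8] -/
theorem isGLB_faceMax (h : IsStrassenPreorder le) {u v x : S}
    (hval : ∀ φ, IsSpectralPoint le φ → φ u ≤ φ v) {φ₀ : S → ℝ} (hφ₀ : IsSpectralPoint le φ₀)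
    (hφ₀f : φ₀ u = φ₀ v) (hmax : ∀ ψ, IsSpectralPoint le ψ → ψ u = ψ v → ψ x ≤ φ₀ x) :
    IsGLB {t : ℝ | ∃ p q n : ℕ, 0 < q ∧ t = (p : ℝ) / q ∧
      AsympLe le ((q : S) * x + (n : S) * u) ((p : S) + (n : S) * v)} (φ₀ x) := by
  constructor
  · rintro t ⟨p, q, n, hq, rfl, hc⟩
    have h1 := face_le_of_cert h hc φ₀ hφ₀ hφ₀f
    have hq' : (0 : ℝ) < q := Nat.cast_pos.2 hq
    rw [le_div_iff₀ hq']
    linarith [mul_comm (q : ℝ) (φ₀ x)]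
  · intro t ht
    by_contra hlt
    push Not at hlt
    have hx0 : 0 ≤ φ₀ x := hφ₀.nonneg h x
    -- a rational `p/q` with `φ₀ x < p/q < t`
    obtain ⟨q, hq⟩ := exists_nat_gt (2 / (t - φ₀ x))
    have hq0 : (0 : ℝ) < q := lt_trans (div_pos two_pos (sub_pos.2 hlt)) hq
    have hqt : 2 < (q : ℝ) * (t - φ₀ x) := (div_lt_iff₀ (sub_pos.2 hlt)).1 hq
    obtain ⟨p, hp1, hp2⟩ : ∃ p : ℕ, (q : ℝ) * φ₀ x < p ∧ (p : ℝ) ≤ q * φ₀ x + 1 := by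
      refine ⟨⌊(q : ℝ) * φ₀ x⌋₊ + 1, ?_, ?_⟩
      · push_cast
        exact Nat.lt_floor_add_one _
      · push_cast
        linarith [Nat.floor_le (mul_nonneg hq0.le hx0)]
    have H : ∀ φ, IsSpectralPoint le φ → φ u = φ v → (q : ℝ) * φ x < p := fun φ hφ hφf =>
      lt_of_le_of_lt (mul_le_mul_of_nonneg_left (hmax φ hφ hφf) hq0.le) hp1
    obtain ⟨k, n, hk, hc⟩ := exists_pos_cert_of_faceLt h hval ⟨φ₀, hφ₀, hφ₀f⟩ H
    have hkq : 0 < k * q := Nat.mul_pos hk (by exact_mod_cast hq0)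
    have hmem : ((k * p : ℕ) : ℝ) / ((k * q : ℕ) : ℝ) ∈ {t : ℝ | ∃ p q n : ℕ, 0 < q ∧
        t = (p : ℝ) / q ∧ AsympLe le ((q : S) * x + (n : S) * u) ((p : S) + (n : S) * v)} :=
      ⟨k * p, k * q, n, hkq, rfl, hc⟩
    have h2 := ht hmem
    have hk0 : (k : ℝ) ≠ 0 := by exact_mod_cast hk.ne'
    have h3 : ((k * p : ℕ) : ℝ) / ((k * q : ℕ) : ℝ) = (p : ℝ) / q := by
      push_cast
      exact mul_div_mul_left _ _ hk0
    rw [h3] at h2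
    have h4 : (p : ℝ) / q < t := by
      rw [div_lt_iff₀ hq0]
      linarith [mul_sub (q : ℝ) t (φ₀ x), mul_comm t (q : ℝ)]
    linarith

/-- **The face maximum as an infimum of certificate ratios**:
`max_{Z(u,v)} φ(x) = inf {p/q : q ≥ 1, ∃ n, q·x + n·u ≼~ p + n·v}`.
[cite: Zuiddam2018, Thm. 2.12, Cor. 2.13, Thm. 2.15] -/
theorem faceMax_eq_sInf (h : IsStrassenPreorder le) {u v x : S}
    (hval : ∀ φ, IsSpectralPoint le φ → φ u ≤ φ v) {φ₀ : S → ℝ} (hφ₀ : IsSpectralPoint le φ₀)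
    (hφ₀f : φ₀ u = φ₀ v) (hmax : ∀ ψ, IsSpectralPoint le ψ → ψ u = ψ v → ψ x ≤ φ₀ x) :
    φ₀ x = sInf {t : ℝ | ∃ p q n : ℕ, 0 < q ∧ t = (p : ℝ) / q ∧
      AsympLe le ((q : S) * x + (n : S) * u) ((p : S) + (n : S) * v)} := by
  refine ((isGLB_faceMax h hval hφ₀ hφ₀f hmax).csInf_eq ⟨(rankOf le x : ℕ) / ((1 : ℕ) : ℝ), ?_⟩).symm
  exact ⟨rankOf le x, 1, 0, one_pos, rfl, cert_rankOf h u v x⟩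

/-- **Natural bounds on a face = certificates at every higher price**: for a valid `u ≼~ v`, `x ∈ S`
and `c ∈ ℕ`:  `(∀ φ ∈ Z(u,v), φ(x) ≤ c) ⟺ ∀ p q, c·q < p → ∃ n, q·x + n·u ≼~ p + n·v`
(integrality: `c·q ≤ p − 1`, so the `+1` of the normal form is absorbed).
[cite: Zuiddam2018, Thm. 2.12, Thm. 2.15] -/
theorem faceLe_nat_iff_certs (h : IsStrassenPreorder le) (u v x : S) (c : ℕ)
    (hval : ∀ φ, IsSpectralPoint le φ → φ u ≤ φ v) :
    (∀ φ, IsSpectralPoint le φ → φ u = φ v → φ x ≤ c) ↔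
    ∀ p q : ℕ, c * q < p → ∃ n : ℕ,
      AsympLe le ((q : S) * x + (n : S) * u) ((p : S) + (n : S) * v) := by
  constructor
  · intro H p q hpq
    -- `q·φ(x) ≤ c·q ≤ p - 1` on the face; the normal form's `+1` then gives exactly `p`
    obtain ⟨n, hn⟩ := asympLe_of_faceLe h hval (x := (q : S) * x) (y := ((p - 1 : ℕ) : S))
      (fun φ hφ hφf => by
        rw [hφ.map_mul, hφ.map_natCast, hφ.map_natCast]
        have h1 : (q : ℝ) * φ x ≤ q * c := mul_le_mul_of_nonneg_left (H φ hφ hφf) (Nat.cast_nonneg q)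
        have h2 : ((c * q : ℕ) : ℝ) ≤ ((p - 1 : ℕ) : ℝ) := by exact_mod_cast Nat.le_sub_one_of_lt hpq
        push_cast at h2
        linarith [mul_comm (q : ℝ) (c : ℝ)])
    refine ⟨n, ?_⟩
    have e : ((p - 1 : ℕ) : S) + (n : S) * v + 1 = (p : S) + (n : S) * v := by
      have hp0 : 0 < p := lt_of_le_of_lt (Nat.zero_le _) hpq
      have hp : p - 1 + 1 = p := Nat.sub_add_cancel (Nat.succ_le_of_lt hp0)
      calc ((p - 1 : ℕ) : S) + (n : S) * v + 1 = (((p - 1 + 1 : ℕ)) : S) + (n : S) * v := by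
            push_cast; ring
        _ = (p : S) + (n : S) * v := by rw [hp]
    rw [← e]
    exact hn
  · intro H φ hφ hφf
    refine le_of_forall_pos_lt_add fun ε hε => ?_
    obtain ⟨q, hq⟩ := exists_nat_gt (1 / ε)
    have hq0 : (0 : ℝ) < q := lt_trans (by positivity) hq
    obtain ⟨n, hc⟩ := H (c * q + 1) q (Nat.lt_succ_self _)
    have h1 := face_le_of_cert h hc φ hφ hφf
    push_cast at h1
    -- `q φ(x) ≤ c q + 1`, i.e. `φ(x) ≤ c + 1/q < c + ε`
    have h2 : 1 < (q : ℝ) * ε := by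
      have := (div_lt_iff₀ hε).1 hq
      linarith
    by_contra hcon
    push Not at hcon
    have h3 : (q : ℝ) * (c + ε) ≤ q * φ x := mul_le_mul_of_nonneg_left hcon hq0.le
    linarith [mul_add (q : ℝ) (c : ℝ) ε, mul_comm (q : ℝ) (c : ℝ)]

/-! ## §3  Face versus top fibre: subsidies -/

/-- `q·a ≼~ p ⟺ q·R̃(a) ≤ p` (for `1 ≼ a`, so that the top fibre is nonempty).
[cite: Zuiddam2018, Thm. 2.12, Cor. 2.13] -/
theorem asympLe_natMul_natCast_iff (h : IsStrassenPreorder le) {a : S} (ha : le 1 a) (p q : ℕ) :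
    AsympLe le ((q : S) * a) (p : S) ↔ (q : ℝ) * asympRankOf le a ≤ p := by
  constructor
  · intro hle
    obtain ⟨φ, hφ, hφa⟩ := h.exists_isSpectralPoint_eq_asympRankOf a ha
    have h1 := (h.asympLe_iff_forall_spectralPoint.1 hle) φ hφ
    rw [hφ.map_mul, hφ.map_natCast, hφ.map_natCast, hφa] at h1
    exact h1
  · intro H
    refine h.asympLe_of_forall_spectralPoint _ _ fun φ hφ => ?_
    rw [hφ.map_mul, hφ.map_natCast, hφ.map_natCast]
    have h1 : φ a ≤ asympRankOf le a := hφ.le_asympRankOf h a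
    nlinarith [Nat.cast_nonneg (α := ℝ) q]

/-- **The face MEETS the top fibre iff bundling never subsidises `a`.**  For a valid `u ≼~ v` with
nonempty face and `1 ≼ a`:
`(∃ φ ∈ Z(u,v), φ(a) = R̃(a)) ⟺ ∀ p q n, (q·a + n·u ≼~ p + n·v) → (q·a ≼~ p)`.
(⟹: evaluate at the top face point; ⟸: otherwise `max_Z φ(a) < R̃(a)` and a certificate strictly
between undercuts the global price `R̃(a)`.) [cite: Zuiddam2018, Thm. 2.12, Cor. 2.13, Thm. 2.15] -/
theorem face_meets_top_iff_noSubsidy (h : IsStrassenPreorder le) {u v a : S}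
    (hval : ∀ φ, IsSpectralPoint le φ → φ u ≤ φ v)
    (hne : ∃ φ : S → ℝ, IsSpectralPoint le φ ∧ φ u = φ v) (ha : le 1 a) :
    (∃ φ : S → ℝ, IsSpectralPoint le φ ∧ φ u = φ v ∧ φ a = asympRankOf le a) ↔
    ∀ p q n : ℕ, AsympLe le ((q : S) * a + (n : S) * u) ((p : S) + (n : S) * v) →
      AsympLe le ((q : S) * a) (p : S) := by
  constructor
  · rintro ⟨φ, hφ, hφf, hφa⟩ p q n hc
    rw [asympLe_natMul_natCast_iff h ha]
    have h1 := face_le_of_cert h hc φ hφ hφf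
    rwa [hφa] at h1
  · intro H
    by_contra hno
    push Not at hno
    -- the face maximum of `φ(a)` is `< R̃(a)`
    obtain ⟨φ₀, hφ₀, hφ₀f, hmax⟩ := exists_face_isMaxOn h hne a
    set A := asympRankOf le a with hA
    have hlt : φ₀ a < A := lt_of_le_of_ne (hφ₀.le_asympRankOf h a) (hno φ₀ hφ₀ hφ₀f)
    have ha0 : 0 ≤ φ₀ a := hφ₀.nonneg h a
    -- a rational `p/q` with `φ₀ a < p/q` and `p ≤ q φ₀(a) + 1 < q A - 1`
    obtain ⟨q, hq⟩ := exists_nat_gt (2 / (A - φ₀ a))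
    have hq0 : (0 : ℝ) < q := lt_trans (div_pos two_pos (sub_pos.2 hlt)) hq
    have hqA : 2 < (q : ℝ) * (A - φ₀ a) := (div_lt_iff₀ (sub_pos.2 hlt)).1 hq
    obtain ⟨p, hp1, hp2⟩ : ∃ p : ℕ, (q : ℝ) * φ₀ a < p ∧ (p : ℝ) ≤ q * φ₀ a + 1 := by
      refine ⟨⌊(q : ℝ) * φ₀ a⌋₊ + 1, ?_, ?_⟩
      · push_cast
        exact Nat.lt_floor_add_one _
      · push_cast
        linarith [Nat.floor_le (mul_nonneg hq0.le ha0)]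
    have H' : ∀ φ, IsSpectralPoint le φ → φ u = φ v → (q : ℝ) * φ a < p := fun φ hφ hφf =>
      lt_of_le_of_lt (mul_le_mul_of_nonneg_left (hmax φ hφ hφf) hq0.le) hp1
    obtain ⟨k, n, hk, hc⟩ := exists_pos_cert_of_faceLt h hval hne H'
    have h2 := (asympLe_natMul_natCast_iff h ha (k * p) (k * q)).1 (H _ _ _ hc)
    push_cast at h2
    have hk0 : (0 : ℝ) < k := by exact_mod_cast hk
    -- `k q A ≤ k p ≤ k (q φ₀ a + 1)` contradicts `q (A - φ₀ a) > 2`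
    have h3 : (k : ℝ) * (q * A) ≤ k * (q * φ₀ a + 1) := by
      nlinarith [mul_le_mul_of_nonneg_left hp2 hk0.le]
    have h4 : (q : ℝ) * A ≤ q * φ₀ a + 1 := le_of_mul_le_mul_left h3 hk0
    linarith [mul_sub (q : ℝ) A (φ₀ a)]

/-- **The face MISSES the top fibre iff some certificate undercuts the global price** (a SUBSIDY):
`(∀ φ ∈ Z(u,v), φ(a) < R̃(a)) ⟺ ∃ p q n, p < q·R̃(a) ∧ q·a + n·u ≼~ p + n·v`.
[cite: Zuiddam2018, Thm. 2.12, Cor. 2.13, Thm. 2.15] -/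
theorem face_misses_top_iff_subsidy (h : IsStrassenPreorder le) {u v a : S}
    (hval : ∀ φ, IsSpectralPoint le φ → φ u ≤ φ v)
    (hne : ∃ φ : S → ℝ, IsSpectralPoint le φ ∧ φ u = φ v) (ha : le 1 a) :
    (∀ φ : S → ℝ, IsSpectralPoint le φ → φ u = φ v → φ a < asympRankOf le a) ↔
    ∃ p q n : ℕ, (p : ℝ) < q * asympRankOf le a ∧
      AsympLe le ((q : S) * a + (n : S) * u) ((p : S) + (n : S) * v) := by
  have key := face_meets_top_iff_noSubsidy h hval hne ha
  constructor
  · intro H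
    have hno : ¬ ∃ φ : S → ℝ, IsSpectralPoint le φ ∧ φ u = φ v ∧ φ a = asympRankOf le a := by
      rintro ⟨φ, hφ, hφf, hφa⟩
      exact absurd hφa (H φ hφ hφf).ne
    rw [key] at hno
    push Not at hno
    obtain ⟨p, q, n, hc, hnot⟩ := hno
    refine ⟨p, q, n, ?_, hc⟩
    rw [asympLe_natMul_natCast_iff h ha] at hnot
    push Not at hnot
    exact hnot
  · rintro ⟨p, q, n, hpq, hc⟩ φ hφ hφf
    refine lt_of_le_of_ne (hφ.le_asympRankOf h a) fun hφa => ?_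
    have h1 := face_le_of_cert h hc φ hφ hφf
    rw [hφa] at h1
    linarith

end Summit.MatrixMultiplication.MatrixMultiplication.Theorems.OutsiderSandwichFaceCertificates
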